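import Summits.QuantumFields.YangMills.Theorems.BalabanUVNodesPortS1LocPowSeries
import Literature.MathematicalPhysics.QuantumFieldTheory.Balaban1983to89.B10LogDet63

/-!
# NODE O port PT-A — [16] (63) LOCALIZED, AT ONE CONFIGURATION: for a real positive definite `T` whose complexification is a sum of exponentially localized pieces `Σ_Y T_Y` and whose
# resolvent trace is resummed by pieces `E_X(x)` (the `G3C` input), `−½ log det T + ½·(#S)·log R = Σ_{X ∈ 𝐃} [½∫₀^R E_X(x) dx + powMemberPiece … X]` — the pointwise heart of the v3.3 glue
# `stub_LZdetGlue` of 27930's line `pta_residueW` (the constant `½·(#S)·log R` cancels in print's difference (61), `log det T(U_{k+1}) − log det T(1)`)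

Cell `ym-nodeO-ideate`, porter seat `ymgap-nodeO-port-PTA-1` (gen 7); `--supports stmt-QuantumFields-27930` (helper, P0-free).  [16] = [Balaban1985UV3], [I] = [Balaban1987RG1], [II] = [Balaban1988RG2Cluster].
Inputs by name: ✓`B10LogDet63.matrix63_of_form_le` ((63) on `[0, 2γ₁]` under a form bound), ✓`…LocPowSeries.sum_powMemberPiece_eq` ∕ `touchSum_torus_le` (the power members localized and
resummed), generic over a finite index type `S` (at the record: `NonB0Idx`), the torus catalogue `TDom d N`, a cube map `cube : S → (ℤ∕N)^d`.
* §1 casting the real resolvent ∕ powers to `ℂ`: `map_ofReal_inv_eq`, `trace_map_ofReal`, `trace_resolvent_ofReal`, `trace_pow_ofReal`, `isUnit_det_resolvent`.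
* §2 ★★★ `logDet63_localized_at` — the identity above, under: `T ≻ 0` with form bound `γ₁ ≤ R∕2`; `T.map ofReal = Σ_Y T_Y` with supports in the domains `Y`, operator-norm decay
  `‖T_Y‖ ≤ c e^{−δ d(Y)}`, `κ₀(4·2^d, 2d) ≤ δ∕2 − 1`, radius `R ≥ 2·c·(4·2^d K₀)·e^{δ}`; the resummed resolvent pieces `Σ_X E_X(x) = Tr (x·1 + Σ_Y T_Y)⁻¹` for `x ≥ 0`, continuous in `x` on `[0, R]`.

HONEST FRAMING.  Finite-dimensional linear algebra + the tree's (63) + this seat's power-member files; NOTHING of Bałaban's estimates asserted; the record instantiation (P0-ℂ letter's `TY`, G3C's `EG`,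
the germ `T = recordPreckLoc ∘ portVkAx`) is the glue's next file; `stub_P0C` ∕ `stub_G3C` ∕ `stub_LZdetGlue` ∕ `stub_FE` OPEN; 27930 OPEN (stubs 2∕6 by name) · no claim; NODE O 0∕1; COUNT 8∕28 · K 1∕4 UNMOVED;
finite `𝕋⁴_{L^K}` at fixed ε — NOT continuum ∕ OS ∕ Clay; **the Yang–Mills mass gap is NOT proved by any of this.**  No `sorry`, no `def`, no `instance`; standard axioms.
-/

open scoped BigOperators Matrix.Norms.L2Operator
open Finset

namespace Summit.QuantumFields.YangMills.Theorems.BalabanUVNodesPortS1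

open Literature.MathematicalPhysics.QuantumFieldTheory.Balaban1983to89
open Literature.MathematicalPhysics.QuantumFieldTheory.Balaban1983to89.TreeLengthTorus (TPt IsTDom TDom torusTreeLen torusTreeLen_nonneg)
open Literature.MathematicalPhysics.QuantumFieldTheory.Balaban1983to89.B12TreeDecay (K₀ kappa₀)

/-! ## §1  Casting the real resolvent and the real powers to `ℂ` -/

section Cast

variable {S : Type} [Fintype S] [DecidableEq S]

/-- `(T⁻¹).map ofReal = (T.map ofReal)⁻¹` for an invertible real matrix. [folklore] -/
theorem map_ofReal_inv_eq (T : Matrix S S ℝ) (hT : IsUnit T.det) : (T⁻¹).map (Complex.ofReal) = (T.map (Complex.ofReal))⁻¹ := by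
  have h : T.map (Complex.ofReal) * (T⁻¹).map (Complex.ofReal) = 1 := by
    show T.map ⇑Complex.ofRealHom * (T⁻¹).map ⇑Complex.ofRealHom = 1
    rw [← Matrix.map_mul, Matrix.mul_nonsing_inv _ hT, Matrix.map_one _ (map_zero _) (map_one _)]
  exact (Matrix.inv_eq_right_inv h).symm

omit [DecidableEq S] in
/-- `Tr (M.map ofReal) = (Tr M : ℂ)`. [folklore] -/
theorem trace_map_ofReal (M : Matrix S S ℝ) : (M.map (Complex.ofReal)).trace = ((M.trace : ℝ) : ℂ) := by
  simp [Matrix.trace, Matrix.map_apply]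

/-- The resolvent `x·1 + T` of a positive definite real matrix is invertible for `x ≥ 0`. [folklore] -/
theorem isUnit_det_resolvent {T : Matrix S S ℝ} (hT : T.PosDef) {x : ℝ} (hx : 0 ≤ x) : IsUnit (x • (1 : Matrix S S ℝ) + T).det := by
  have hpd : (x • (1 : Matrix S S ℝ) + T).PosDef := by
    rw [add_comm]
    exact hT.add_posSemidef (Matrix.PosSemidef.one.smul hx)
  exact isUnit_iff_ne_zero.2 hpd.det_pos.ne'

/-- `(Tr (x·1 + T)⁻¹ : ℂ) = Tr (x·1 + T.map ofReal)⁻¹` for `T ≻ 0`, `x ≥ 0`. [folklore] -/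
theorem trace_resolvent_ofReal {T : Matrix S S ℝ} (hT : T.PosDef) {x : ℝ} (hx : 0 ≤ x) :
    (((x • (1 : Matrix S S ℝ) + T)⁻¹.trace : ℝ) : ℂ) = (((x : ℂ) • (1 : Matrix S S ℂ) + T.map (Complex.ofReal))⁻¹).trace := by
  rw [← trace_map_ofReal, map_ofReal_inv_eq _ (isUnit_det_resolvent hT hx)]
  congr 2
  ext i j
  simp [Matrix.map_apply, Matrix.one_apply, Matrix.smul_apply]
  split_ifs <;> simp

/-- `(Tr Tᵐ : ℂ) = Tr (T.map ofReal)ᵐ`. [folklore] -/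
theorem trace_pow_ofReal (T : Matrix S S ℝ) (m : ℕ) : ((Matrix.trace (T ^ m) : ℝ) : ℂ) = Matrix.trace ((T.map (Complex.ofReal)) ^ m) := by
  rw [← trace_map_ofReal]
  show ((T ^ m).map ⇑Complex.ofRealHom).trace = ((T.map ⇑Complex.ofRealHom) ^ m).trace
  rw [Matrix.map_pow]

end Cast

/-! ## §2  ★★★ (63) localized at one configuration -/

section Local63

variable {S : Type} [Fintype S] [DecidableEq S] {d N : ℕ} [NeZero N] [DecidableEq (TDom d N)]

omit [DecidableEq S] [NeZero N] [DecidableEq (TDom d N)] in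
/-- A form bound is monotone in its constant: `v·Tv ≤ γ₁ v·v`, `γ₁ ≤ γ` ⇒ `v·Tv ≤ γ v·v`. [folklore] -/
theorem form_le_mono {T : Matrix S S ℝ} {γ₁ γ : ℝ} (hform : ∀ v : S → ℝ, dotProduct v (T.mulVec v) ≤ γ₁ * dotProduct v v) (hγ : γ₁ ≤ γ) (v : S → ℝ) :
    dotProduct v (T.mulVec v) ≤ γ * dotProduct v v := by
  have hvv : 0 ≤ dotProduct v v := by
    unfold dotProduct; exact sum_nonneg fun i _ => mul_self_nonneg _
  exact (hform v).trans (mul_le_mul_of_nonneg_right hγ hvv)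

/-- ★★★ **(63) LOCALIZED AT ONE CONFIGURATION.**  `T ≻ 0` real with `⟨v, Tv⟩ ≤ γ₁‖v‖²` and `2γ₁ ≤ R`; its complexification is `Σ_Y T_Y` over the torus localization domains with the pieces supported
in their domains (`cube s ∉ Y ∨ cube s' ∉ Y ⇒ (T_Y)_{ss'} = 0`) and `‖T_Y‖ ≤ c e^{−δ d(Y)}`, `κ₀(4·2^d,2d) ≤ δ∕2 − 1`, `R ≥ 2·c·(4·2^d K₀(4·2^d,2d))·e^δ`; the resolvent trace is resummed by pieces
`E_X(x)`, `Σ_X E_X(x) = Tr (x·1 + Σ_Y T_Y)⁻¹` for `x ≥ 0`, each continuous in `x` on `[0, R]`.  THEN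
`−½ log det T + ½·#S·log R = Σ_{X ∈ 𝐃} [½∫₀^R E_X(x) dx + powMemberPiece … X]`.
[cite: Balaban1985UV3, (63) p.271–272, (23)–(25) p.262; Balaban1987RG1, (1.7) p.261, (1.18) p.263; Balaban1988RG2Cluster, (2.27) p.18, (1.26) p.8] -/
theorem logDet63_localized_at (cube : S → TPt d N) (TYb : TDom d N → Matrix S S ℂ) (EGx : ℝ → TDom d N → ℂ)
    {T : Matrix S S ℝ} (hT : T.PosDef) {γ₁ R c δ : ℝ} (hγ₁ : 0 < γ₁)
    (hform : ∀ v : S → ℝ, dotProduct v (T.mulVec v) ≤ γ₁ * dotProduct v v) (hR : 2 * γ₁ ≤ R)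
    (hTC : T.map (Complex.ofReal) = ∑ Y, TYb Y)
    (hsupp : ∀ Y s s', (cube s ∉ (Y.1 : Finset (TPt d N)) ∨ cube s' ∉ (Y.1 : Finset (TPt d N))) → TYb Y s s' = 0)
    (hc : 0 ≤ c) (hδ : kappa₀ (4 * 2 ^ d) (2 * d) ≤ δ / 2 - 1)
    (hTY : ∀ Y, ‖TYb Y‖ ≤ c * Real.exp (-(δ * torusTreeLen Y.1)))
    (hRc : 2 * (c * (4 * 2 ^ d * K₀ (4 * 2 ^ d) (2 * d)) * Real.exp δ) ≤ R)
    (hg1 : ∀ x : ℝ, 0 ≤ x → ∑ X, EGx x X = (((x : ℂ) • (1 : Matrix S S ℂ) + ∑ Y, TYb Y)⁻¹).trace)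
    (hcont : ∀ X, ContinuousOn (fun x => EGx x X) (Set.Icc 0 R)) :
    (((-(1 / 2) * Real.log T.det + (1 / 2) * (Fintype.card S : ℝ) * Real.log R : ℝ)) : ℂ)
      = ∑ X : TDom d N, ((1 / 2 : ℂ) * (∫ x in (0 : ℝ)..R, EGx x X) + powMemberPiece (fun Y : TDom d N => (Y.1 : Finset (TPt d N))) TYb R X.1) := by
  -- constants
  have hR0 : 0 < R := by linarith
  have hδ0 : 0 ≤ δ := by
    have := B12TreeDecay.kappa₀_nonneg (by positivity : (0 : ℝ) ≤ 4 * 2 ^ d) (2 * d)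
    linarith
  have hKc : 0 ≤ 4 * 2 ^ d * K₀ (4 * 2 ^ d) (2 * d) := by
    have := B12TreeDecay.K₀_pos (4 * 2 ^ d) (2 * d)
    positivity
  -- (63) at γ₁' := R/2
  have h63 := B10LogDet63.matrix63_of_form_le hT (by linarith : 0 < R / 2) (form_le_mono hform (by linarith : γ₁ ≤ R / 2))
  have h2 : 2 * (R / 2) = R := by ring
  simp only [h2] at h63
  -- the power members, localized and resummed
  have hsuppD : ∀ Y : TDom d N, IsTDom (Y.1 : Finset (TPt d N)) := fun Y => Y.2
  have hcount := fun Y : Finset (TPt d N) => touchSum_torus_le (d := d) (N := N) hδ Y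
  have hpow := sum_powMemberPiece_eq (cube := cube) (supp := fun Y : TDom d N => (Y.1 : Finset (TPt d N))) (T := TYb)
    hsuppD hsupp hc hδ0 hKc hR0 hRc hTY hcount
  -- the resolvent member: cast, then resum under the integral
  have hint : ∀ X : TDom d N, IntervalIntegrable (fun x => EGx x X) MeasureTheory.volume 0 R := fun X =>
    (hcont X).intervalIntegrable_of_Icc hR0.le
  have hres : (((∫ x in (0 : ℝ)..R, ((x • (1 : Matrix S S ℝ) + T)⁻¹).trace) : ℝ) : ℂ)
      = ∑ X : TDom d N, ∫ x in (0 : ℝ)..R, EGx x X := by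
    rw [← intervalIntegral.integral_ofReal, ← intervalIntegral.integral_finsetSum (fun X _ => hint X)]
    refine intervalIntegral.integral_congr fun x hx => ?_
    rw [Set.uIcc_of_le hR0.le] at hx
    show (((x • (1 : Matrix S S ℝ) + T)⁻¹.trace : ℝ) : ℂ) = ∑ X, EGx x X
    rw [trace_resolvent_ofReal hT hx.1, hTC, hg1 x hx.1]
  -- the power series cast
  have hser : (((∑' j : ℕ, (-1) ^ (j + 1) / (2 * ((j : ℝ) + 1)) * (R ^ (j + 1))⁻¹ * (T ^ (j + 1)).trace) : ℝ) : ℂ)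
      = ∑' j : ℕ, (coef63 R j : ℂ) * Matrix.trace ((∑ Y, TYb Y) ^ (j + 1)) := by
    rw [Complex.ofReal_tsum]
    refine tsum_congr fun j => ?_
    rw [Complex.ofReal_mul, trace_pow_ofReal, hTC]
    rfl
  -- assemble
  have hmain : (((-(1 / 2) * Real.log T.det) : ℝ) : ℂ)
      = (1 / 2 : ℂ) * (∑ X : TDom d N, ∫ x in (0 : ℝ)..R, EGx x X) - (((1 / 2) * (Fintype.card S : ℝ) * Real.log R : ℝ) : ℂ)
        + ∑ X : TDom d N, powMemberPiece (fun Y : TDom d N => (Y.1 : Finset (TPt d N))) TYb R X.1 := by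
    rw [h63, Complex.ofReal_add, hser, ← hpow, Complex.ofReal_sub, Complex.ofReal_mul, hres]
    push_cast
    ring
  rw [Complex.ofReal_add, hmain, sum_add_distrib, mul_sum]
  push_cast
  ring

end Local63

end Summit.QuantumFields.YangMills.Theorems.BalabanUVNodesPortS1
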